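/-
Copyright: the b2b-balaban T⁴-continuum CRUX team, row NE7b OWNER lineage `t4-ne7b-p1` (gen 124). Project licence.
-/
import Summits.QuantumFields.BalabanUV.T4Continuum.Spine.NE7b.SupZdCoarseInverseOperator
import Mathlib.Analysis.SpecificLimits.Normed

/-!
# THE `H + K` COLUMN ON `ℤ^d`, EXISTENCE AND UNIQUENESS: for `V : ℤ^d → [−λ, Λ]` (`d ≥ 3`, every mesh) and ANY kernel `K` on `ℤ^d` with
# `|K(p,q)| ≤ εe^{−γ|p − q|₁}` (fine-scale exponential locality, as in (163)'s torus class) and the smallness `εK_γC₀ ≤ 1∕2` (`C₀` = (188)'s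
# `ℓ^∞` bound of `H_V⁻¹`), the perturbed Hessian `H_V + K` is BOUNDEDLY INVERTIBLE on `ℓ^∞(ℤ^d)`: `G_K = (1 + H_V⁻¹K)⁻¹H_V⁻¹ ∈ L(ℓ^∞)`,
# `‖G_K‖ ≤ 2C₀`, `(H_V + K)G_Kf = f`, and every bounded solution of `(H_V + K)u = f` is `G_Kf` — the Neumann series in the Banach algebra
# `L(ℓ^∞(ℤ^d))` plus (181)∕(188)'s uniqueness, iterated as a contraction of the sup bound (row NE7b, node U5c; (188)∕(189)∕(203) BY NAME;
# [folklore])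

Cell `pub-balaban`, sub-cell `t4`, spine estimate NE7b (`T4WeightBudget.RelWeightBound`; the cell's OWN estimate — NOT PRINTED in
[Bałaban 1983–89], NOT PROVED).  Crux-route work under `Spine/NE7b/` by the row OWNER (`t4-ne7b-p1` gen 124, file (213)) under FREEZE
(0)'s crux-prover clause — § [NE7bP1-G123-HANDOFF] NEXT (3)(b) «the `H + K` column on `ℤ^d`», existence half; NOTHING of Bałaban's is named
as a Lean object, valued or asserted; no `T4Continuum/Support` leaf typed; no `def`, no notation (operators are `∃` of Mathlib's `→L[ℝ]` on
`lp (fun _ : X d => ℝ) ∞`, the perturbed equation DISPLAYED with `Σ′_qK(p,q)u(q)`); zero `sorry`.  Imports (BY NAME): the OWNER's (203)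
`…SupZdCoarseInverseOperator` (`kernel_clm`; through it (189) `summable_kernel_row`, `tsum_kernel_row_le`, (188) `exists_zd_propagator_clm`,
(48) `abs_apply_le_norm`), Mathlib's `Mathlib.Analysis.SpecificLimits.Normed` (`mul_neg_geom_series`, `geom_series_mul_neg` — the Neumann
series `Σ(−A)^i` in a complete normed ring), `ContinuousLinearMap.opNorm_le_bound ∕ le_opNorm ∕ opNorm_comp_le`, `memℓp_infty`,
`lp.norm_le_of_forall_le`, `tendsto_pow_atTop_nhds_zero_of_lt_one`.

WHY (located).  After one step the next action's Hessian is not a nearest-neighbour form but `template + K` with an exponentially local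
`K` ((135)∕(162)); (162)–(177) re-ran the torus column for `H + K` by energy (weighted resolvent) arguments.  On `ℤ^d` there is no finite
energy for bounded solutions, but (188) gave `H_V⁻¹ = G ∈ L(ℓ^∞)` with `‖G‖ ≤ C₀` and (189) gives `‖K‖_{ℓ^∞→ℓ^∞} ≤ εK_γ`, so `A = GK` has
`‖A‖ ≤ 1∕2` and `S = Σ_i(−A)^i = (1 + A)⁻¹` exists in the Banach algebra (`‖Sv‖ ≤ 2‖v‖` from `Sv + A(Sv) = v`); `u = SGf` satisfies
`u = G(f − Ku)`, i.e. `H_Vu = f − Ku` ((188)'s display).  Uniqueness of BOUNDED solutions: the difference `w` solves `H_Vw = −Kw`, so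
`w = G(−Kw)` ((188)'s uniqueness clause = (181)) and `sup|w| ≤ C₀εK_γ·sup|w| ≤ sup|w|∕2`; iterating, `sup|w| ≤ B∕2^k → 0`.

WHAT IS PROVED ([folklore]; `ℓ^∞ = lp (fun _ : X d => ℝ) ∞`): §1 **`neumann_inverse`** (`‖G‖‖K‖ ≤ 1∕2` ⟹ `∃ S ∈ L(ℓ^∞)`: `Sv + GK(Sv) = v`,
`S(v + GKv) = v`, `‖Sv‖ ≤ 2‖v‖`); §2 **`zd_perturbed_null`** (a bounded solution of `H_Vw = −Σ′_qK(·,q)w(q)` vanishes, given (188)'s `G`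
with `‖G‖ ≤ C₀` and its uniqueness clause, `εK_γC₀ ≤ 1∕2`); §3 **`zd_perturbed_inverse_clm`** (THE END: `∃ C₀ > 0`: for ALL `n, V`, `ε ≥ 0`,
`γ > 0` with `εK_γC₀ ≤ 1∕2`, every `K` of the class: `∃ G_K ∈ L(ℓ^∞)`, `‖G_K‖ ≤ 2C₀`, `H_V(G_Kf) + Σ′_qK(·,q)(G_Kf)(q) = f`, and every bounded
solution `u` of the perturbed equation has `u = G_Kf` pointwise); §4 toy.

HONEST (what this is NOT).  Existence ∕ uniqueness ∕ `ℓ^∞` bound only — the DECAY of `G_K`'s kernel (the analogue of (164)∕(174)), the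
perturbed coarse operator `Q′G_KQ′*` and its inverse on `ℤ^d`, and the torus → `ℤ^d` limit for `H + K` are the sequel; the smallness is
`εK_γC₀ ≤ 1∕2` with (188)'s `C₀` (the sup road's constant), NOT (163)'s energy threshold `εK_γ < min(2,a) − λ`; symmetry of `K` is not
used; the LINEAR column only; `d ≥ 3` only; scalar skeleton ((A3), NC-NE7b-α UNRULED); nothing of the covariant propagators of [B4]–[B6];
nothing of Bałaban's asserted.  BY-NAME EFFECT ON THE WALL: NONE.  NE7b NOT PRINTED ∕ NOT PROVED; spine PROVED 0∕9; rung (B)+1 — the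
programme's measures remain FINITE-torus statements; NOT the mass gap, NOT Clay.  HONEST DEPENDENCY: continuum YM on T⁴ ⇐ BetaPertH ∧
nine spine estimates (0∕9 proved); BetaPertH ⇐ (D1) ∧ (D4) ∧ CAP+tail; G-an2-4 gates asym, D1 and NE2∕3∕4.
-/

set_option autoImplicit false

noncomputable section

namespace Summit.QuantumFields.BalabanUV.T4Continuum.NE7b.SupZdPerturbedOperator

open Real Filter Topology
open scoped ENNReal
open Literature.MathematicalPhysics.QuantumFieldTheory.Balaban1983to89
open B6QGQLower276 (X e blk B side chart mem_B sum_B sum_B_const card_cube blk_chart)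
open SupZdPropagatorOperator (exists_zd_propagator_clm)
open SupZdCoarseInverseOperator (kernel_clm)
open OneShotChartSupOperator (abs_apply_le_norm)

variable {d : ℕ}

/-! ## §1. The Neumann series in `L(ℓ^∞(ℤ^d))` -/

/-- **NEUMANN INVERSE**: for bounded operators `G, K` on `ℓ^∞(ℤ^d)` with `‖G‖·‖K‖ ≤ 1∕2` there is `S ∈ L(ℓ^∞)` with `Sv + GK(Sv) = v`,
`S(v + GKv) = v` and `‖Sv‖ ≤ 2‖v‖` — `S = Σ_i(−GK)^i` in the Banach algebra `L(ℓ^∞)`. [folklore] -/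
theorem neumann_inverse (G Kop : lp (fun _ : X d => ℝ) ∞ →L[ℝ] lp (fun _ : X d => ℝ) ∞) (hGK : ‖G‖ * ‖Kop‖ ≤ 1 / 2) :
    ∃ S : lp (fun _ : X d => ℝ) ∞ →L[ℝ] lp (fun _ : X d => ℝ) ∞,
      (∀ v, S v + G (Kop (S v)) = v) ∧ (∀ v, S (v + G (Kop v)) = v) ∧ (∀ v, ‖S v‖ ≤ 2 * ‖v‖) := by
  obtain ⟨A, hA⟩ : ∃ A : lp (fun _ : X d => ℝ) ∞ →L[ℝ] lp (fun _ : X d => ℝ) ∞, A = G.comp Kop := ⟨_, rfl⟩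
  have hAv : ∀ v, A v = G (Kop v) := fun v => by rw [hA]; rfl
  have hAnorm : ‖A‖ ≤ 1 / 2 := by rw [hA]; exact (ContinuousLinearMap.opNorm_comp_le _ _).trans hGK
  have hAlt : ‖-A‖ < 1 := by rw [norm_neg]; linarith
  obtain ⟨S, hS⟩ : ∃ S : lp (fun _ : X d => ℝ) ∞ →L[ℝ] lp (fun _ : X d => ℝ) ∞, S = ∑' i : ℕ, (-A) ^ i := ⟨_, rfl⟩
  have hS1 : (1 + A) * S = 1 := by
    have h := mul_neg_geom_series (-A) hAlt
    rwa [← hS, sub_neg_eq_add] at h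
  have hS2 : S * (1 + A) = 1 := by
    have h := geom_series_mul_neg (-A) hAlt
    rwa [← hS, sub_neg_eq_add] at h
  have hS1v : ∀ v, S v + A (S v) = v := fun v => by
    have h := DFunLike.congr_fun hS1 v
    change S v + A (S v) = v at h
    exact h
  have hS2v : ∀ v, S (v + A v) = v := fun v => by
    have h := DFunLike.congr_fun hS2 v
    change S (v + A v) = v at h
    exact h
  refine ⟨S, fun v => by rw [← hAv]; exact hS1v v, fun v => by rw [← hAv]; exact hS2v v, fun v => ?_⟩
  have h1 : S v = v - A (S v) := eq_sub_of_add_eq (hS1v v)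
  have h2 : ‖S v‖ ≤ ‖v‖ + ‖A (S v)‖ := by
    calc ‖S v‖ = ‖v - A (S v)‖ := congrArg norm h1
      _ ≤ ‖v‖ + ‖A (S v)‖ := norm_sub_le v (A (S v))
  have h3 : ‖A (S v)‖ ≤ 1 / 2 * ‖S v‖ := (A.le_opNorm (S v)).trans (mul_le_mul_of_nonneg_right hAnorm (norm_nonneg _))
  linarith

/-! ## §2. Uniqueness of bounded solutions of the perturbed equation -/

/-- **BOUNDED SOLUTIONS OF `H_Vw = −Kw` VANISH** when `εK_γC₀ ≤ 1∕2` (`C₀` = (188)'s bound, `G = H_V⁻¹ ∈ L(ℓ^∞)` with the uniqueness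
clause): `w = G(−Kw)` ((188)), so `sup|w| ≤ C₀εK_γ·sup|w| ≤ sup|w|∕2`, and iterating `sup|w| ≤ B∕2^k → 0`. [folklore] -/
theorem zd_perturbed_null (n : ℕ) (a : ℝ) (V : X d → ℝ) {C₀ ε γ : ℝ} (hC₀ : 0 < C₀) (hε : 0 ≤ ε) (hγ : 0 < γ)
    (hsmall : ε * (2 * (1 - exp (-γ))⁻¹) ^ d * C₀ ≤ 1 / 2)
    (K : X d → X d → ℝ) (hK : ∀ p q, |K p q| ≤ ε * exp (-(γ * ∑ i, (((p i - q i).natAbs : ℕ) : ℝ))))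
    (G : lp (fun _ : X d => ℝ) ∞ →L[ℝ] lp (fun _ : X d => ℝ) ∞) (hGnorm : ‖G‖ ≤ C₀)
    (hGuniq : ∀ (g : lp (fun _ : X d => ℝ) ∞) (u : X d → ℝ) (Bu : ℝ), (∀ p, |u p| ≤ Bu) →
      (∀ p, ((n : ℝ) + 1) ^ 2 * ∑ μ, (2 * u p - u (p + e μ) - u (p - e μ))
        + a / ((n : ℝ) + 1) ^ d * ∑ q ∈ B n (blk n p), u q + V p * u p = g p) → ∀ p, G g p = u p)
    (w : X d → ℝ) (Bw : ℝ) (hwB : ∀ p, |w p| ≤ Bw)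
    (hw : ∀ p, ((n : ℝ) + 1) ^ 2 * ∑ μ, (2 * w p - w (p + e μ) - w (p - e μ))
      + a / ((n : ℝ) + 1) ^ d * ∑ q ∈ B n (blk n p), w q + V p * w p = -(∑' q : X d, K p q * w q)) :
    ∀ p, w p = 0 := by
  classical
  have hKδ : 0 ≤ (2 * (1 - exp (-γ))⁻¹) ^ d :=
    pow_nonneg (mul_nonneg zero_le_two (inv_nonneg.2 (sub_nonneg.2 (exp_le_one_iff.2 (by linarith))))) d
  obtain ⟨Kop, hKnorm, hKop⟩ := kernel_clm (d := d) hε hγ K hK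
  -- contraction of the sup bound
  have hcontr : ∀ B : ℝ, (∀ q, |w q| ≤ B) → ∀ q, |w q| ≤ B / 2 := by
    intro B hB q
    have hB0 : 0 ≤ B := (abs_nonneg _).trans (hB q)
    have hmem : Memℓp w ∞ := memℓp_infty ⟨B, by
      rintro _ ⟨q, rfl⟩
      show ‖w q‖ ≤ B
      rw [Real.norm_eq_abs]; exact hB q⟩
    obtain ⟨wl, hwl⟩ : ∃ wl : lp (fun _ : X d => ℝ) ∞, ∀ q, wl q = w q := ⟨⟨w, hmem⟩, fun _ => rfl⟩
    have hwl_norm : ‖wl‖ ≤ B := lp.norm_le_of_forall_le hB0 fun q => by rw [Real.norm_eq_abs, hwl]; exact hB q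
    obtain ⟨g, hg⟩ : ∃ g : lp (fun _ : X d => ℝ) ∞, g = -Kop wl := ⟨_, rfl⟩
    have hg_apply : ∀ q, g q = -(∑' q' : X d, K q q' * w q') := fun q => by
      rw [hg, lp.coeFn_neg, Pi.neg_apply, hKop]
      exact congrArg _ (tsum_congr fun q' => by rw [hwl])
    have hwG : ∀ q, G g q = w q := hGuniq g w B hB fun q => by rw [hg_apply]; exact hw q
    have hGg : ‖G g‖ ≤ C₀ * (ε * (2 * (1 - exp (-γ))⁻¹) ^ d * B) := by
      calc ‖G g‖ ≤ ‖G‖ * ‖g‖ := G.le_opNorm g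
        _ ≤ C₀ * (‖Kop‖ * ‖wl‖) := by
            rw [hg, norm_neg]; exact mul_le_mul hGnorm (Kop.le_opNorm wl) (norm_nonneg _) hC₀.le
        _ ≤ C₀ * (ε * (2 * (1 - exp (-γ))⁻¹) ^ d * B) :=
            mul_le_mul_of_nonneg_left (mul_le_mul hKnorm hwl_norm (norm_nonneg _) (by positivity)) hC₀.le
    calc |w q| = |G g q| := by rw [hwG q]
      _ ≤ ‖G g‖ := abs_apply_le_norm (G g) q
      _ ≤ C₀ * (ε * (2 * (1 - exp (-γ))⁻¹) ^ d * B) := hGg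
      _ ≤ B / 2 := by nlinarith
  -- iterate
  have hiter : ∀ k : ℕ, ∀ q, |w q| ≤ Bw / 2 ^ k := by
    intro k
    induction k with
    | zero => intro q; simpa using hwB q
    | succ k ih => intro q; have h := hcontr _ ih q; rw [pow_succ, ← div_div]; exact h
  have hlim : Tendsto (fun k : ℕ => Bw / 2 ^ k) atTop (𝓝 0) := by
    have h := (tendsto_pow_atTop_nhds_zero_of_lt_one (by norm_num : (0 : ℝ) ≤ 1 / 2) (by norm_num)).const_mul Bw
    rw [mul_zero] at h
    refine h.congr fun k => ?_
    show Bw * (1 / 2) ^ k = Bw / 2 ^ k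
    rw [one_div, inv_pow, div_eq_mul_inv]
  intro p
  exact abs_nonpos_iff.1 (le_of_tendsto_of_tendsto' tendsto_const_nhds hlim fun k => hiter k p)

/-! ## §3. THE END: `(H_V + K)⁻¹ ∈ L(ℓ^∞(ℤ^d))` for small exponentially local kernels -/

/-- **HEADLINE — THE PERTURBED HESSIAN IS INVERTIBLE ON `ℓ^∞(ℤ^d)`**: `d ≥ 3`, `a > 0`, `λ < min(2,a)`, `Λ ≥ 0` ⟹ `∃ C₀ > 0` (from `(d, a, λ, Λ)`
ONLY; (188)'s bound of `H_V⁻¹`) such that for ALL `n`, `V : ℤ^d → [−λ, Λ]`, every rate `γ > 0` and every kernel `K` on `ℤ^d` with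
`|K(p,q)| ≤ ε·e^{−γ|p − q|₁}` (fine scale) and the smallness `ε·K_γ·C₀ ≤ 1∕2` (`K_γ = (2∕(1 − e^{−γ}))^d`): there is `G_K ∈ L(ℓ^∞(ℤ^d))` with
`‖G_K‖ ≤ 2C₀`, `H_V(G_Kf) + Σ′_qK(·,q)(G_Kf)(q) = f` for every `f ∈ ℓ^∞`, and every BOUNDED solution `u` of `H_Vu + Σ′_qK(·,q)u(q) = f` is
`G_Kf` pointwise — `G_K = (1 + H_V⁻¹K)⁻¹H_V⁻¹` (§1), uniqueness by §2 on the difference.  The existence-and-uniqueness half of the `H + K`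
column ON `ℤ^d`; decay of `G_K`'s kernel is the sequel. [folklore] -/
theorem zd_perturbed_inverse_clm (hd : 3 ≤ d) (a : ℝ) (ha : 0 < a) {lam Lam : ℝ} (hlam : lam < min 2 a) (hLam : 0 ≤ Lam) :
    ∃ C₀ : ℝ, 0 < C₀ ∧ ∀ (n : ℕ) (V : X d → ℝ), (∀ p, -lam ≤ V p) → (∀ p, V p ≤ Lam) →
      ∀ (ε γ : ℝ), 0 ≤ ε → 0 < γ → ε * (2 * (1 - exp (-γ))⁻¹) ^ d * C₀ ≤ 1 / 2 →
      ∀ (K : X d → X d → ℝ), (∀ p q, |K p q| ≤ ε * exp (-(γ * ∑ i, (((p i - q i).natAbs : ℕ) : ℝ)))) →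
      ∃ GK : lp (fun _ : X d => ℝ) ∞ →L[ℝ] lp (fun _ : X d => ℝ) ∞,
        ‖GK‖ ≤ 2 * C₀ ∧
        (∀ (f : lp (fun _ : X d => ℝ) ∞) (p : X d),
          ((n : ℝ) + 1) ^ 2 * ∑ μ, (2 * GK f p - GK f (p + e μ) - GK f (p - e μ))
            + a / ((n : ℝ) + 1) ^ d * ∑ q ∈ B n (blk n p), GK f q + V p * GK f p + ∑' q : X d, K p q * GK f q = f p) ∧
        (∀ (f : lp (fun _ : X d => ℝ) ∞) (u : X d → ℝ) (Bu : ℝ), (∀ p, |u p| ≤ Bu) →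
          (∀ p, ((n : ℝ) + 1) ^ 2 * ∑ μ, (2 * u p - u (p + e μ) - u (p - e μ))
            + a / ((n : ℝ) + 1) ^ d * ∑ q ∈ B n (blk n p), u q + V p * u p + ∑' q : X d, K p q * u q = f p) →
          ∀ p, u p = GK f p) := by
  classical
  obtain ⟨C₀, hC₀, H188⟩ := exists_zd_propagator_clm (d := d) hd a ha hlam hLam
  refine ⟨C₀, hC₀, ?_⟩
  intro n V hV hV' ε γ hε hγ hsmall K hK
  obtain ⟨G, hGnorm, hGeq, hGuniq⟩ := H188 n V hV hV'
  obtain ⟨Kop, hKnorm, hKop⟩ := kernel_clm (d := d) hε hγ K hK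
  have hKδ : 0 ≤ (2 * (1 - exp (-γ))⁻¹) ^ d :=
    pow_nonneg (mul_nonneg zero_le_two (inv_nonneg.2 (sub_nonneg.2 (exp_le_one_iff.2 (by linarith))))) d
  have hGK : ‖G‖ * ‖Kop‖ ≤ 1 / 2 :=
    (mul_le_mul hGnorm hKnorm (norm_nonneg _) hC₀.le).trans (by nlinarith)
  obtain ⟨S, hS1v, -, hSv⟩ := neumann_inverse (d := d) G Kop hGK
  -- the equation for `u = S(Gf)`: `u + G(K u) = Gf`, i.e. `u = G(f − Ku)`, so `H_Vu = f − Ku`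
  have heq : ∀ (f : lp (fun _ : X d => ℝ) ∞) (p : X d),
      ((n : ℝ) + 1) ^ 2 * ∑ μ, (2 * S (G f) p - S (G f) (p + e μ) - S (G f) (p - e μ))
        + a / ((n : ℝ) + 1) ^ d * ∑ q ∈ B n (blk n p), S (G f) q + V p * S (G f) p + ∑' q : X d, K p q * S (G f) q = f p := by
    intro f p
    have huG : G (f - Kop (S (G f))) = S (G f) := by
      rw [map_sub, sub_eq_iff_eq_add, hS1v]
    have h := hGeq (f - Kop (S (G f))) p
    rw [huG, lp.coeFn_sub, Pi.sub_apply, hKop] at h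
    rw [h, sub_add_cancel]
  refine ⟨S.comp G, ?_, fun f p => heq f p, fun f u Bu huB hu p => ?_⟩
  · -- the norm
    refine ContinuousLinearMap.opNorm_le_bound _ (by positivity) fun f => ?_
    calc ‖(S.comp G) f‖ = ‖S (G f)‖ := rfl
      _ ≤ 2 * ‖G f‖ := hSv (G f)
      _ ≤ 2 * (C₀ * ‖f‖) := mul_le_mul_of_nonneg_left ((G.le_opNorm f).trans (mul_le_mul_of_nonneg_right hGnorm (norm_nonneg _))) zero_le_two
      _ = 2 * C₀ * ‖f‖ := by ring
  · -- uniqueness: `w = u − S(Gf)` is a bounded solution of `H_Vw = −Kw`, hence zero (§2)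
    obtain ⟨w, hw⟩ : ∃ w : X d → ℝ, ∀ q, w q = u q - S (G f) q := ⟨_, fun _ => rfl⟩
    have hwB : ∀ q, |w q| ≤ Bu + ‖S (G f)‖ := fun q => by
      rw [hw]; exact (abs_sub _ _).trans (add_le_add (huB q) (abs_apply_le_norm (S (G f)) q))
    have hrowu : ∀ q, Summable (fun q' : X d => K q q' * u q') :=
      fun q => SupZdExponentialSums.summable_kernel_row hγ K hK u huB q
    have hrowv : ∀ q, Summable (fun q' : X d => K q q' * S (G f) q') :=
      fun q => SupZdExponentialSums.summable_kernel_row hγ K hK (fun q' => S (G f) q') (fun q' => abs_apply_le_norm (S (G f)) q') q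
    have hweq : ∀ q, ((n : ℝ) + 1) ^ 2 * ∑ μ, (2 * w q - w (q + e μ) - w (q - e μ))
        + a / ((n : ℝ) + 1) ^ d * ∑ q' ∈ B n (blk n q), w q' + V q * w q = -(∑' q' : X d, K q q' * w q') := by
      intro q
      have h1 := hu q
      have h2 := heq f q
      have hsub : ∑' q' : X d, K q q' * w q' = ∑' q' : X d, K q q' * u q' - ∑' q' : X d, K q q' * S (G f) q' := by
        rw [← Summable.tsum_sub (hrowu q) (hrowv q)]
        exact tsum_congr fun q' => by rw [hw]; ring
      have e1 : ∑ μ, (2 * w q - w (q + e μ) - w (q - e μ))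
          = ∑ μ, (2 * u q - u (q + e μ) - u (q - e μ)) - ∑ μ, (2 * S (G f) q - S (G f) (q + e μ) - S (G f) (q - e μ)) := by
        rw [← Finset.sum_sub_distrib]; exact Finset.sum_congr rfl fun μ _ => by rw [hw, hw, hw]; ring
      have e2 : ∑ q' ∈ B n (blk n q), w q' = ∑ q' ∈ B n (blk n q), u q' - ∑ q' ∈ B n (blk n q), S (G f) q' := by
        rw [← Finset.sum_sub_distrib]; exact Finset.sum_congr rfl fun q' _ => hw q'
      rw [e1, e2, hsub]
      linear_combination h1 - h2 + V q * hw q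
    have h0 := zd_perturbed_null (d := d) n a V hC₀ hε hγ hsmall K hK G hGnorm hGuniq w _ hwB hweq p
    rw [hw, sub_eq_zero] at h0
    rw [h0]
    rfl

/-! ## §2. Toy -/

/-- Toy (`d = 3`, `a = 1`, `λ = 0`, `Λ = 1`): the smallness scale `C₀` exists. -/
example : ∃ C₀ : ℝ, 0 < C₀ :=
  let ⟨C₀, hC₀, _⟩ := zd_perturbed_inverse_clm (d := 3) le_rfl 1 one_pos (lam := 0) (Lam := 1)
    (by rw [min_eq_right (by norm_num : (1 : ℝ) ≤ 2)]; norm_num) zero_le_one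
  ⟨C₀, hC₀⟩

end Summit.QuantumFields.BalabanUV.T4Continuum.NE7b.SupZdPerturbedOperator
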